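import Literature.Analysis.FluidPDE.ESSLocalHolderCovering
import Literature.Analysis.FluidPDE.NSSuitableESSEpsilonProofs
import Literature.Analysis.FluidPDE.PressureDecayEstimateProofs
import Literature.Analysis.FluidPDE.SuitableWeakInBallTools
import Literature.Analysis.FluidPDE.CKNEpsilonRegularityLemma142Holds
import HarnessLib

/-!
# ESS Thm. 1.4 (`ess_local_holder`): scale-invariant bounds at a point of concentration and the
# rescaled family (ESS 2003, §3, (3.8)–(3.12); Seregin 2014, Prop. 6.20, set-up)

Analysis/FluidPDE proofs-only file (theorems only: no definitions, no named facts), second file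
of the bottom-up discharge of `Literature.Analysis.FluidPDE.ess_local_holder` (L. Escauriaza,
G. Seregin, V. Šverák, Russ. Math. Surveys 58:2 (2003) 211–250, Thm. 1.4). The first file
(`ESSLocalHolderCovering.lean`) reduced Thm. 1.4 to ε-regularity plus the absence of points of
`ε`-concentration of `|v|³ + |p|^{3/2}` in `Q̄(1/2)`
(`ess_local_holder_of_epsilonRegularity_of_noConcentration`). The absence of such points is
proved in print by contradiction — the blow-up argument of ESS §3 / G. Seregin, *Lecture Notes on
Regularity Theory for the Navier–Stokes Equations* (2014), §6.6, Prop. 6.20: around a point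
`z₀` with `r⁻² ∫_{Q(z₀,r)} (|v|³ + |p|^{3/2}) ≥ ε` for all `0 < r ≤ 1/2` the pair is rescaled,
`u^λ(s, y) = λ v(t₀ + λ² s, x₀ + λ y)`, `p^λ(s, y) = λ² p(t₀ + λ² s, x₀ + λ y)`, `λ → 0`, and a
subsequence converges to a non-trivial local energy ancient solution. This file supplies the
**scale-invariant bookkeeping at such a point** which makes the rescaled family pre-compact and
its limits non-trivial:

* `lintegral_cube_add_pressure_eq_cknC_add_cknD` — the concentration quantity is
  `C(r; z₀) + D(r; z₀)` (`cknC`, `cknD`);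
* `exists_cknC_le` — `C(r; z₀) ≤ M` for all `z₀ ∈ Q̄(1/2)`, `0 < r ≤ 1/2`, with `M` the sliced
  `L³` bound (1.16) (`∫_{Q(z₀,r)} |v|³ ≤ r² ess sup_t ‖v(t)‖₃³`);
* `exists_cknD_le` — **the pressure stays bounded along the scales**: `D(r; z₀) ≤ D⋆` for
  `0 < r ≤ 1/2` (iteration of the decay estimate `D(θr) ≤ c(θ D(r) + θ⁻² C(r))`, proved in the
  tree as `seregin_sverak_pressure_decay_holds`, along `r = θⁿ/2` with `cθ ≤ 1/2`; Seregin 2014,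
  p. 126 "boundedness of `g'`"; ESS §3 (3.11));
* `exists_cknC_ge_of_concentration` — **at a point of `ε`-concentration the velocity alone
  concentrates**: `C(ρ; z₀) ≥ η > 0` for all `0 < ρ ≤ 1/2` (if `C(ρ) < η` at one scale, the decay
  estimate gives `C + D < ε` at the scale `θρ`) — this is what survives in the blow-up limit, the
  pressure converging only weakly ("we cannot simply pass to the limit … since it is not clear
  whether the pressure converges strongly", Seregin 2014, p. 127);
* `zoom_isSuitableWeakSolutionInBall`, `lintegral_cube_zoom_le`, `lintegral_pressure_zoom_le`,
  `eLpNorm_zoom_add_le` — the rescaled pairs `(u^λ, p^λ)`, `0 < λ ≤ 1/2`, are suitable weak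
  solutions on the unit parabolic ball (proved `ess_suitable_of_L3infty'_holds` and the bridge
  `IsESSSuitablePairOn.isSuitableWeakSolutionInBall_unit`) with
  `‖u^λ‖_{L³(Q(1))} + ‖p^λ‖_{L^{3/2}(Q(1))}` bounded independently of `λ` — the hypotheses of the
  compactness theorem `SuitableCompactness_holds` (Albritton–Barker 2019, Lemma 2.2);
* `lintegral_cube_zoom_radius`, `lintegral_pressure_zoom_radius`, `cknC_zoom`, `cknD_zoom`,
  `ofReal_sq_mul_eta_le_lintegral_cube_zoom` — scale covariance
  `∫_{Q(a)} |u^λ|³ = a² C(aλ; z₀)`, `∫_{Q(a)} |p^λ|^{3/2} = a² D(aλ; z₀)`, whence the lower bound `∫_{Q(a)} |u^λ|³ ≥ η a²` at a point of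
  concentration, for every `0 < a`, `aλ ≤ 1/2` (Seregin 2014, (6.6.1));
* `exists_ae_lintegral_ball_cube_zoom_le` — the sliced bound `∫_{B(1/(2λ))} |u^λ(s)|³ ≤ M` for a.e.
  `s ∈ ]-3/(4λ²), 0[` (scale invariance of `L_{3,∞}`, Seregin 2014, p. 129).

Nothing accepted is restated or changed; no `sorry`.

## References

* L. Escauriaza, G. Seregin, V. Šverák, Russ. Math. Surveys 58:2 (2003) 211–250: Thm. 1.4, §3
  (3.8)–(3.12). [`EscauriazaSereginSverak2003`]
* G. Seregin, *Lecture Notes on Regularity Theory for the Navier–Stokes Equations*, World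
  Scientific (2014), §6.6, Prop. 6.20, (6.6.1), pp. 126–129. [`Seregin2014`]
* G. Seregin, V. Šverák, Comm. PDE 34 (2009) = arXiv:0804.1803, proof of Lemma 3.5, (as13) (the
  decay estimate for the pressure). [`SereginSverak2009`]
* D. Albritton, T. Barker, J. Math. Fluid Mech. 21 (2019), Lemma 2.2. [`AlbrittonBarker2019`]
-/

noncomputable section

open MeasureTheory Set Function Filter Topology TopologicalSpace Metric
open scoped NNReal ENNReal

namespace Literature.Analysis.FluidPDE

/-! ### Geometry of `Q̄(1/2)` inside `Q(1)` -/

/-- A point of `Q̄(1/2)` has `-1/4 ≤ t₀ ≤ 0` and `|x₀| ≤ 1/2`. [folklore] -/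
theorem mem_closure_half_iff {z₀ : ℝ × EuclideanSpace ℝ (Fin 3)} :
    z₀ ∈ closure (parabolicCylinder (1 / 2) ((0 : ℝ), (0 : EuclideanSpace ℝ (Fin 3)))) ↔
      (-(1 / 4) ≤ z₀.1 ∧ z₀.1 ≤ 0) ∧ ‖z₀.2‖ ≤ 1 / 2 := by
  rw [closure_parabolicCylinder_half_origin, mem_prod, mem_Icc, mem_closedBall, dist_zero_right]

/-- For `z₀ ∈ Q̄(1/2)` and `0 ≤ r ≤ 1/2`, `Q(z₀, r) ⊆ Q(1)`. [folklore] -/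
theorem parabolicCylinder_subset_unit_of_mem_closure_half {z₀ : ℝ × EuclideanSpace ℝ (Fin 3)}
    (hz₀ : z₀ ∈ closure (parabolicCylinder (1 / 2) ((0 : ℝ), (0 : EuclideanSpace ℝ (Fin 3)))))
    {r : ℝ} (hr0 : 0 ≤ r) (hr : r ≤ 1 / 2) :
    parabolicCylinder r z₀ ⊆ parabolicCylinder 1 ((0 : ℝ), (0 : EuclideanSpace ℝ (Fin 3))) := by
  obtain ⟨⟨ht, ht'⟩, hx⟩ := mem_closure_half_iff.1 hz₀
  rw [parabolicCylinder_one_zero, parabolicCylinder]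
  have hr2 : r ^ 2 ≤ 1 / 4 := by nlinarith
  exact prod_mono (Ioo_subset_Ioo (by linarith) ht') (ball_subset_unitBall_of_half hx hr)

/-- For `z₀ ∈ Q̄(1/2)` and `0 ≤ r ≤ 1/2`, the time interval of `Q(z₀, r)` lies in `]-1, 0[` and
its ball in `B(1)`. [folklore] -/
theorem intervals_subset_of_mem_closure_half {z₀ : ℝ × EuclideanSpace ℝ (Fin 3)}
    (hz₀ : z₀ ∈ closure (parabolicCylinder (1 / 2) ((0 : ℝ), (0 : EuclideanSpace ℝ (Fin 3)))))
    {r : ℝ} (hr0 : 0 ≤ r) (hr : r ≤ 1 / 2) :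
    Ioo (z₀.1 - r ^ 2) z₀.1 ⊆ Ioo (-1 : ℝ) 0 ∧
      ball z₀.2 r ⊆ ball (0 : EuclideanSpace ℝ (Fin 3)) 1 := by
  obtain ⟨⟨ht, ht'⟩, hx⟩ := mem_closure_half_iff.1 hz₀
  have hr2 : r ^ 2 ≤ 1 / 4 := by nlinarith
  exact ⟨Ioo_subset_Ioo (by linarith) ht', ball_subset_unitBall_of_half hx hr⟩

/-! ### The concentration quantity is `C + D` -/

section Quantities

variable {v : ℝ → EuclideanSpace ℝ (Fin 3) → EuclideanSpace ℝ (Fin 3)}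
  {p : ℝ → EuclideanSpace ℝ (Fin 3) → ℝ}

/-- **The concentration quantity of Lemma 2.2 is `C(r; z₀) + D(r; z₀)`**:
`r⁻² ∫_{Q(z₀,r)} (|v|³ + |p|^{3/2}) = C(r; z₀) + D(r; z₀)` (`cknC`, `cknD`), for a pair with
`v` a.e. strongly measurable on the cylinder. [cite: EscauriazaSereginSverak2003, Lemma 2.2 (2.5) and §3] -/
theorem lintegral_cube_add_pressure_eq_cknC_add_cknD {r : ℝ} (hr : 0 < r)
    {z₀ : ℝ × EuclideanSpace ℝ (Fin 3)}
    (hv : AEStronglyMeasurable (uncurry v) (volume.restrict (parabolicCylinder r z₀))) :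
    ENNReal.ofReal ((r ^ 2)⁻¹) * ∫⁻ w in parabolicCylinder r z₀,
        (‖v w.1 w.2‖ₑ ^ 3 + ‖p w.1 w.2‖ₑ ^ (3 / 2 : ℝ)) = cknC r z₀ v + cknD r z₀ p := by
  have hmeas : AEMeasurable (fun w : ℝ × EuclideanSpace ℝ (Fin 3) => ‖v w.1 w.2‖ₑ ^ 3)
      (volume.restrict (parabolicCylinder r z₀)) := hv.enorm.pow_const 3
  rw [lintegral_add_left' hmeas, mul_add, cknC, cknD, Lemma142.inv_ofReal_sq hr]

/-- **`C(r; z₀) ≤ M` at every `z₀ ∈ Q̄(1/2)` and every scale `0 < r ≤ 1/2`**, where `M` is the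
sliced `L³` bound (1.16) of the pair on `Q(1)`:
`∫_{Q(z₀,r)} |v|³ ≤ r² · ess sup_t ∫_{B(1)} |v(t)|³` (Tonelli). [cite: EscauriazaSereginSverak2003, §3 (3.9)–(3.10)] -/
theorem exists_cknC_le
    (h : IsL3inftyLocalPair 1 1 ((0 : ℝ), (0 : EuclideanSpace ℝ (Fin 3))) v p) :
    ∃ M : ℝ≥0, ∀ z₀ ∈ closure (parabolicCylinder (1 / 2) ((0 : ℝ), (0 : EuclideanSpace ℝ (Fin 3)))),
      ∀ r ∈ Ioc (0 : ℝ) (1 / 2), cknC r z₀ v ≤ M := by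
  obtain ⟨-, -, -, -, ⟨C₃, h5⟩⟩ := IsL3inftyLocalPair.unit_iff.1 h
  refine ⟨C₃, fun z₀ hz₀ r hr => ?_⟩
  obtain ⟨hI, hB⟩ := intervals_subset_of_mem_closure_half hz₀ hr.1.le hr.2
  have h5' : ∀ᵐ t ∂(volume.restrict (Ioo (z₀.1 - r ^ 2) z₀.1)),
      ∫⁻ y in ball z₀.2 r, ‖uncurry v (t, y)‖ₑ ^ 3 ≤ C₃ := by
    filter_upwards [ae_restrict_of_ae_restrict_of_subset hI h5] with t ht
    exact (lintegral_mono_set hB).trans ht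
  have h1 : ∫⁻ w in parabolicCylinder r z₀, ‖v w.1 w.2‖ₑ ^ (3 : ℕ) ≤ C₃ * ENNReal.ofReal (r ^ 2) := by
    have h2 := setLIntegral_prod_le_of_slice_bound h5'
    rw [Real.volume_Ioo, show z₀.1 - (z₀.1 - r ^ 2) = r ^ 2 by ring] at h2
    exact h2
  have hr0 : 0 < r := hr.1
  rw [cknC, Lemma142.inv_ofReal_sq hr0]
  calc ENNReal.ofReal ((r ^ 2)⁻¹) * ∫⁻ w in parabolicCylinder r z₀, ‖v w.1 w.2‖ₑ ^ (3 : ℕ)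
      ≤ ENNReal.ofReal ((r ^ 2)⁻¹) * (C₃ * ENNReal.ofReal (r ^ 2)) := mul_le_mul' le_rfl h1
    _ = C₃ := by
        rw [mul_comm (C₃ : ℝ≥0∞), ← mul_assoc, ← ENNReal.ofReal_mul (by positivity),
          inv_mul_cancel₀ (by positivity), ENNReal.ofReal_one, one_mul]

/-- Monotonicity of the un-normalised quantities in the radius:
`∫_{Q(z₀,r)} F ≤ ∫_{Q(z₀,r')} F` for `0 ≤ r ≤ r'`. [folklore] -/
theorem lintegral_parabolicCylinder_mono (F : ℝ × EuclideanSpace ℝ (Fin 3) → ℝ≥0∞)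
    {r r' : ℝ} (hr : 0 ≤ r) (h : r ≤ r') (z₀ : ℝ × EuclideanSpace ℝ (Fin 3)) :
    ∫⁻ w in parabolicCylinder r z₀, F w ≤ ∫⁻ w in parabolicCylinder r' z₀, F w :=
  lintegral_mono_set (parabolicCylinder_mono hr h z₀)

/-- **Comparable scales**: `D(r; z₀) ≤ θ⁻² D(r'; z₀)` whenever `θ r' ≤ r ≤ r'` (`0 < θ`, `0 < r`);
the same computation for any un-normalised functional. [folklore] -/
theorem scaled_le_of_comparable {I : ℝ → ℝ≥0∞} (hI : ∀ ⦃r r'⦄, 0 ≤ r → r ≤ r' → I r ≤ I r')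
    {θ r r' : ℝ} (hθ : 0 < θ) (hr : 0 < r) (h1 : θ * r' ≤ r) (h2 : r ≤ r') :
    (ENNReal.ofReal r ^ 2)⁻¹ * I r ≤
      ENNReal.ofReal ((θ ^ 2)⁻¹) * ((ENNReal.ofReal r' ^ 2)⁻¹ * I r') := by
  have hr' : 0 < r' := hr.trans_le h2
  rw [Lemma142.inv_ofReal_sq hr, Lemma142.inv_ofReal_sq hr', ← mul_assoc, ← ENNReal.ofReal_mul (by positivity)]
  refine mul_le_mul' (ENNReal.ofReal_le_ofReal ?_) (hI hr.le h2)
  rw [← mul_inv, inv_le_inv₀ (by positivity) (by positivity)]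
  calc θ ^ 2 * r' ^ 2 = (θ * r') ^ 2 := by ring
    _ ≤ r ^ 2 := pow_le_pow_left₀ (by positivity) h1 2

end Quantities

/-! ### The pressure stays bounded along the scales (iteration of the decay estimate) -/

section PressureBound

variable {v : ℝ → EuclideanSpace ℝ (Fin 3) → EuclideanSpace ℝ (Fin 3)}
  {p : ℝ → EuclideanSpace ℝ (Fin 3) → ℝ}

/-- `2⁻¹ * (2 * K) = K` in `ℝ≥0∞`. [folklore] -/
theorem ENNReal.inv_two_mul_two_mul (K : ℝ≥0∞) : (2 : ℝ≥0∞)⁻¹ * (2 * K) = K := by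
  rw [← mul_assoc, ENNReal.inv_mul_cancel two_ne_zero ENNReal.ofNat_ne_top, one_mul]

/-- **Boundedness of `D` along the scales** (ESS 2003, §3 (3.11); Seregin 2014, p. 126, the
boundedness of `g'` for the `L_{3,∞}` pair, p. 129: "With the help of Proposition 3.11, it is
not so difficult to show that `g' < +∞`"). For a pair satisfying (1.15)–(1.16) on `Q(1)` and
`z₀ ∈ Q̄(1/2)` there is `D⋆ < ∞` with `D(r; z₀) ≤ D⋆` for all `0 < r ≤ 1/2`. Proof: by the decay
estimate for the pressure (`seregin_sverak_pressure_decay_holds`),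
`D(θ r) ≤ c (θ D(r) + θ⁻² C(r))`, and `C(r) ≤ M` (`exists_cknC_le`); with `c θ ≤ 1/2` the
quantities `Dₙ = D(θⁿ/2)` satisfy `Dₙ₊₁ ≤ Dₙ/2 + K`, hence `Dₙ ≤ D₀ + 2K`, and an arbitrary
`r ∈ ]θⁿ⁺¹/2, θⁿ/2]` is compared with the scale `θⁿ/2` at the cost of a factor `θ⁻²`. [cite: EscauriazaSereginSverak2003, §3 (3.11)] [cite: Seregin2014, §6.6 p. 126 and p. 129] -/
theorem exists_cknD_le
    (h : IsL3inftyLocalPair 1 1 ((0 : ℝ), (0 : EuclideanSpace ℝ (Fin 3))) v p)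
    {z₀ : ℝ × EuclideanSpace ℝ (Fin 3)}
    (hz₀ : z₀ ∈ closure (parabolicCylinder (1 / 2) ((0 : ℝ), (0 : EuclideanSpace ℝ (Fin 3))))) :
    ∃ D : ℝ≥0, ∀ r ∈ Ioc (0 : ℝ) (1 / 2), cknD r z₀ p ≤ D := by
  classical
  obtain ⟨M, hM⟩ := exists_cknC_le h
  obtain ⟨h1, -, -, h4, -⟩ := IsL3inftyLocalPair.unit_iff.1 h
  obtain ⟨c, hc⟩ := seregin_sverak_pressure_decay_holds.ratio
  -- ## the ratio `θ` with `c θ ≤ 1/2`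
  set θ : ℝ := 1 / (2 * ((c : ℝ) + 1)) with hθ
  have hc0 : (0 : ℝ) ≤ c := c.coe_nonneg
  have hθpos : 0 < θ := by positivity
  have hθle : θ ≤ 1 / 2 := by
    rw [hθ, div_le_div_iff₀ (by positivity) (by norm_num)]
    nlinarith
  have hθ1 : θ ≤ 1 := hθle.trans (by norm_num)
  have hθlt1 : θ < 1 := hθle.trans_lt (by norm_num)
  have hcθ : (c : ℝ≥0∞) * ENNReal.ofReal θ ≤ 2⁻¹ := by
    have e1 : (c : ℝ≥0∞) = ENNReal.ofReal (c : ℝ) := (ENNReal.ofReal_coe_nnreal).symm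
    have e2 : (2 : ℝ≥0∞)⁻¹ = ENNReal.ofReal (1 / 2) := by
      rw [one_div, ENNReal.ofReal_inv_of_pos two_pos, ENNReal.ofReal_ofNat]
    rw [e1, e2, ← ENNReal.ofReal_mul hc0]
    apply ENNReal.ofReal_le_ofReal
    rw [hθ, mul_one_div, div_le_div_iff₀ (by positivity) (by norm_num)]
    nlinarith
  -- ## the scales `rₙ = θⁿ / 2`
  set rn : ℕ → ℝ := fun n => θ ^ n / 2 with hrn
  have hrn_pos : ∀ n, 0 < rn n := fun n => by positivity
  have hrn_le : ∀ n, rn n ≤ 1 / 2 := fun n => by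
    have : θ ^ n ≤ 1 := pow_le_one₀ hθpos.le hθ1
    show θ ^ n / 2 ≤ 1 / 2
    linarith
  have hrn_succ : ∀ n, rn (n + 1) = θ * rn n := fun n => by
    show θ ^ (n + 1) / 2 = θ * (θ ^ n / 2)
    rw [pow_succ]; ring
  have hsub : ∀ n, parabolicCylinder (rn n) z₀ ⊆
      ((parabolicCylinderOpens 1 ((0 : ℝ), (0 : EuclideanSpace ℝ (Fin 3))) :
        Opens (ℝ × EuclideanSpace ℝ (Fin 3))) : Set (ℝ × EuclideanSpace ℝ (Fin 3))) :=
    fun n => parabolicCylinder_subset_unit_of_mem_closure_half hz₀ (hrn_pos n).le (hrn_le n)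
  have hsol : IsDistributionalNSSolutionOn
      (parabolicCylinderOpens 1 ((0 : ℝ), (0 : EuclideanSpace ℝ (Fin 3)))) 1 0 v p := h1
  -- ## one step of the iteration
  set K : ℝ≥0∞ := (c : ℝ≥0∞) * ENNReal.ofReal (θ⁻¹ ^ 2) * M with hK
  have hKtop : K ≠ ∞ :=
    ENNReal.mul_ne_top (ENNReal.mul_ne_top ENNReal.coe_ne_top ENNReal.ofReal_ne_top)
      ENNReal.coe_ne_top
  have hstep : ∀ n, cknD (rn (n + 1)) z₀ p ≤ 2⁻¹ * cknD (rn n) z₀ p + K := by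
    intro n
    have h0 := hc _ v p hsol z₀ (rn n) θ (hrn_pos n) hθpos hθ1 (hsub n)
    rw [← hrn_succ] at h0
    calc cknD (rn (n + 1)) z₀ p
        ≤ c * (ENNReal.ofReal θ * cknD (rn n) z₀ p + ENNReal.ofReal (θ⁻¹ ^ 2) * cknC (rn n) z₀ v) := h0
      _ = (c * ENNReal.ofReal θ) * cknD (rn n) z₀ p +
            (c * ENNReal.ofReal (θ⁻¹ ^ 2)) * cknC (rn n) z₀ v := by ring
      _ ≤ 2⁻¹ * cknD (rn n) z₀ p + (c * ENNReal.ofReal (θ⁻¹ ^ 2)) * M :=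
          add_le_add (mul_le_mul' hcθ le_rfl)
            (mul_le_mul' le_rfl (hM z₀ hz₀ _ ⟨hrn_pos n, hrn_le n⟩))
  -- ## `D₀ < ∞`
  set D₀ : ℝ≥0∞ := cknD (rn 0) z₀ p with hD₀
  have hD₀top : D₀ ≠ ∞ := by
    rw [hD₀, cknD]
    refine ENNReal.mul_ne_top (ENNReal.inv_ne_top.2 ?_) ?_
    · exact pow_ne_zero 2 (ENNReal.ofReal_pos.2 (hrn_pos 0)).ne'
    · exact ne_top_of_le_ne_top h4.ne (lintegral_mono_set (hsub 0))
  -- ## the induction `Dₙ ≤ D₀ + 2K`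
  have hind : ∀ n, cknD (rn n) z₀ p ≤ D₀ + 2 * K := by
    intro n
    induction n with
    | zero => exact le_self_add
    | succ n ih =>
        calc cknD (rn (n + 1)) z₀ p ≤ 2⁻¹ * cknD (rn n) z₀ p + K := hstep n
          _ ≤ 2⁻¹ * (D₀ + 2 * K) + K := by gcongr
          _ = 2⁻¹ * D₀ + 2 * K := by
              rw [mul_add, ENNReal.inv_two_mul_two_mul, add_assoc, ← two_mul]
          _ ≤ D₀ + 2 * K := by
              gcongr
              exact mul_le_of_le_one_left' (ENNReal.inv_le_one.2 one_le_two)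
  -- ## an arbitrary scale
  set Dstar : ℝ≥0∞ := ENNReal.ofReal ((θ ^ 2)⁻¹) * (D₀ + 2 * K) with hDstar
  have hDstartop : Dstar ≠ ∞ :=
    ENNReal.mul_ne_top ENNReal.ofReal_ne_top
      (ENNReal.add_ne_top.2 ⟨hD₀top, ENNReal.mul_ne_top ENNReal.ofNat_ne_top hKtop⟩)
  refine ⟨Dstar.toNNReal, fun r hr => ?_⟩
  rw [ENNReal.coe_toNNReal hDstartop]
  -- the scale `n` with `rₙ₊₁ < r ≤ rₙ`
  have hex : ∃ n : ℕ, rn (n + 1) < r := by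
    have ht : Tendsto (fun n : ℕ => θ ^ (n + 1) / 2) atTop (𝓝 (0 / 2)) :=
      ((tendsto_pow_atTop_nhds_zero_of_lt_one hθpos.le hθlt1).comp (tendsto_add_atTop_nat 1)).div_const 2
    rw [zero_div] at ht
    exact (ht.eventually (gt_mem_nhds hr.1)).exists
  have hex2 : ∃ n : ℕ, rn (n + 1) < r ∧ r ≤ rn n := by
    refine ⟨Nat.find hex, Nat.find_spec hex, ?_⟩
    rcases Nat.eq_zero_or_pos (Nat.find hex) with h0 | hpos
    · rw [h0]; show r ≤ θ ^ 0 / 2; simpa using hr.2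
    · have h2 := Nat.find_min hex (Nat.sub_one_lt hpos.ne')
      rw [not_lt, Nat.sub_add_cancel (Nat.succ_le_of_lt hpos)] at h2
      exact h2
  obtain ⟨n, hn1, hn2⟩ := hex2
  have key := scaled_le_of_comparable
    (I := fun s => ∫⁻ w in parabolicCylinder s z₀, ‖p w.1 w.2‖ₑ ^ (3 / 2 : ℝ))
    (fun r r' hr0 hrr' => lintegral_parabolicCylinder_mono _ hr0 hrr' z₀) hθpos hr.1
    (by rw [← hrn_succ]; exact hn1.le) hn2
  calc cknD r z₀ p
      ≤ ENNReal.ofReal ((θ ^ 2)⁻¹) * cknD (rn n) z₀ p := key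
    _ ≤ Dstar := mul_le_mul' le_rfl (hind n)

/-- **At a point of `ε`-concentration the velocity concentrates at every scale** (the content
of Seregin 2014, (6.6.1) and of the remark on p. 127 that the pressure half of the
concentration does not pass to weak limits). Let `(v, p)` satisfy (1.15)–(1.16) on `Q(1)`,
`z₀ ∈ Q̄(1/2)`, `ε > 0`, and suppose `C(r; z₀) + D(r; z₀) ≥ ε` for **all** `0 < r ≤ 1/2`. Then
there is `η > 0` with `C(ρ; z₀) ≥ η` for all `0 < ρ ≤ 1/2`. Indeed, if `C(ρ) < η` at one scale,
then at the scale `θρ` one has `C(θρ) ≤ θ⁻² C(ρ) < θ⁻² η` and, by the decay estimate,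
`D(θρ) ≤ c(θ D⋆ + θ⁻² η)`; choosing first `θ` (against `D⋆`, `exists_cknD_le`) and then `η`,
`(C + D)(θρ) < ε` — a contradiction. [cite: Seregin2014, §6.6 Prop. 6.20 (6.6.1) and p. 127] [cite: EscauriazaSereginSverak2003, §3 (3.12)] -/
theorem exists_cknC_ge_of_concentration
    (h : IsL3inftyLocalPair 1 1 ((0 : ℝ), (0 : EuclideanSpace ℝ (Fin 3))) v p)
    {z₀ : ℝ × EuclideanSpace ℝ (Fin 3)}
    (hz₀ : z₀ ∈ closure (parabolicCylinder (1 / 2) ((0 : ℝ), (0 : EuclideanSpace ℝ (Fin 3)))))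
    {ε : ℝ} (hε : 0 < ε)
    (hbad : ∀ r ∈ Ioc (0 : ℝ) (1 / 2), ENNReal.ofReal ε ≤ cknC r z₀ v + cknD r z₀ p) :
    ∃ η : ℝ, 0 < η ∧ ∀ ρ ∈ Ioc (0 : ℝ) (1 / 2), ENNReal.ofReal η ≤ cknC ρ z₀ v := by
  obtain ⟨D, hD⟩ := exists_cknD_le h hz₀
  obtain ⟨h1, -⟩ := IsL3inftyLocalPair.unit_iff.1 h
  obtain ⟨c, hc⟩ := seregin_sverak_pressure_decay_holds.ratio
  have hc0 : (0 : ℝ) ≤ c := c.coe_nonneg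
  have hD0 : (0 : ℝ) ≤ D := D.coe_nonneg
  -- ## the ratio `θ` and the threshold `η`
  set θ : ℝ := min 1 (ε / (4 * ((c : ℝ) * D + 1))) with hθ
  have hθpos : 0 < θ := lt_min one_pos (by positivity)
  have hθ1 : θ ≤ 1 := min_le_left _ _
  have hθD : (c : ℝ) * θ * D ≤ ε / 4 := by
    have h2 : θ ≤ ε / (4 * ((c : ℝ) * D + 1)) := min_le_right _ _
    have h3 : (c : ℝ) * D * θ ≤ (c : ℝ) * D * (ε / (4 * ((c : ℝ) * D + 1))) :=
      mul_le_mul_of_nonneg_left h2 (by positivity)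
    have h4 : (c : ℝ) * D * (ε / (4 * ((c : ℝ) * D + 1))) ≤ ε / 4 := by
      rw [mul_div_assoc', div_le_div_iff₀ (by positivity) (by norm_num)]
      nlinarith [mul_nonneg hc0 hD0]
    nlinarith
  set η : ℝ := θ ^ 2 * ε / (4 * ((c : ℝ) + 1)) with hη
  have hηpos : 0 < η := by positivity
  have hX : θ⁻¹ ^ 2 * η = ε / (4 * ((c : ℝ) + 1)) := by
    rw [hη]; field_simp
  have hX1 : θ⁻¹ ^ 2 * η ≤ ε / 4 := by
    rw [hX, div_le_div_iff₀ (by positivity) (by norm_num)]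
    nlinarith
  have hX2 : (c : ℝ) * (θ⁻¹ ^ 2 * η) ≤ ε / 4 := by
    rw [hX, mul_div_assoc', div_le_div_iff₀ (by positivity) (by norm_num)]
    nlinarith
  refine ⟨η, hηpos, fun ρ hρ => ?_⟩
  by_contra hlt
  rw [not_le] at hlt
  -- ## the scale `θρ`
  have hθρ : θ * ρ ∈ Ioc (0 : ℝ) (1 / 2) :=
    ⟨by nlinarith [hρ.1], (mul_le_of_le_one_left hρ.1.le hθ1).trans hρ.2⟩
  have hsub : parabolicCylinder ρ z₀ ⊆
      ((parabolicCylinderOpens 1 ((0 : ℝ), (0 : EuclideanSpace ℝ (Fin 3))) :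
        Opens (ℝ × EuclideanSpace ℝ (Fin 3))) : Set (ℝ × EuclideanSpace ℝ (Fin 3))) :=
    parabolicCylinder_subset_unit_of_mem_closure_half hz₀ hρ.1.le hρ.2
  have hsol : IsDistributionalNSSolutionOn
      (parabolicCylinderOpens 1 ((0 : ℝ), (0 : EuclideanSpace ℝ (Fin 3)))) 1 0 v p := h1
  -- `C(θρ) < θ⁻² η`
  have hCcomp := scaled_le_of_comparable
    (I := fun s => ∫⁻ w in parabolicCylinder s z₀, ‖v w.1 w.2‖ₑ ^ (3 : ℕ))
    (fun r r' hr0 hrr' => lintegral_parabolicCylinder_mono _ hr0 hrr' z₀) hθpos hθρ.1 le_rfl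
    (mul_le_of_le_one_left hρ.1.le hθ1)
  have hC : cknC (θ * ρ) z₀ v < ENNReal.ofReal (θ⁻¹ ^ 2 * η) := by
    refine lt_of_le_of_lt hCcomp ?_
    rw [ENNReal.ofReal_mul (by positivity), inv_pow]
    exact ENNReal.mul_lt_mul_right (ENNReal.ofReal_pos.2 (by positivity)).ne'
      ENNReal.ofReal_ne_top hlt
  -- `D(θρ) ≤ c θ D⋆ + c θ⁻² η`
  have hDle : cknD (θ * ρ) z₀ p ≤ ENNReal.ofReal ((c : ℝ) * θ * D + (c : ℝ) * (θ⁻¹ ^ 2 * η)) := by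
    have h0 := hc _ v p hsol z₀ ρ θ hρ.1 hθpos hθ1 hsub
    refine h0.trans ?_
    have e1 : (c : ℝ≥0∞) = ENNReal.ofReal (c : ℝ) := (ENNReal.ofReal_coe_nnreal).symm
    have e2 : (D : ℝ≥0∞) = ENNReal.ofReal (D : ℝ) := (ENNReal.ofReal_coe_nnreal).symm
    calc (c : ℝ≥0∞) * (ENNReal.ofReal θ * cknD ρ z₀ p + ENNReal.ofReal (θ⁻¹ ^ 2) * cknC ρ z₀ v)
        ≤ (c : ℝ≥0∞) * (ENNReal.ofReal θ * D + ENNReal.ofReal (θ⁻¹ ^ 2) * ENNReal.ofReal η) :=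
          mul_le_mul' le_rfl (add_le_add (mul_le_mul' le_rfl (hD ρ hρ)) (mul_le_mul' le_rfl hlt.le))
      _ = ENNReal.ofReal ((c : ℝ) * θ * D + (c : ℝ) * (θ⁻¹ ^ 2 * η)) := by
          rw [e1, e2, ← ENNReal.ofReal_mul hθpos.le, ← ENNReal.ofReal_mul (by positivity),
            ← ENNReal.ofReal_add (by positivity) (by positivity), ← ENNReal.ofReal_mul hc0]
          ring_nf
  -- ## the contradiction at the scale `θρ`
  have hsum : cknC (θ * ρ) z₀ v + cknD (θ * ρ) z₀ p < ENNReal.ofReal ε := by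
    have h2 := ENNReal.add_lt_add_of_lt_of_le (ne_top_of_le_ne_top ENNReal.ofReal_ne_top hDle)
      hC hDle
    refine h2.trans_le ?_
    rw [← ENNReal.ofReal_add (by positivity) (by positivity)]
    apply ENNReal.ofReal_le_ofReal
    linarith
  exact absurd (hbad (θ * ρ) hθρ) (not_le.2 hsum)

end PressureBound

/-! ### The rescaled family `u^R(s, y) = R v(t₀ + R² s, x₀ + R y)`, `p^R = R² p ∘ Φ_R` -/

section Zoom

variable {v : ℝ → EuclideanSpace ℝ (Fin 3) → EuclideanSpace ℝ (Fin 3)}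
  {p : ℝ → EuclideanSpace ℝ (Fin 3) → ℝ}

/-- **The rescaled pairs are suitable weak solutions on the unit parabolic ball** (ESS 2003,
§3, first paragraph of the proof of Thm. 1.4 and (3.8)–(3.9): "`ṽ` and `p̃` satisfy all
conditions of Theorem 1.4", and pairs with (1.15)–(1.16) "form a suitable weak solution"). For
`(v, p)` with (1.15)–(1.16) on `Q(1)`, `z₀ ∈ Q̄(1/2)` and `0 < R ≤ 1/2`, the zoom
`u^R = R v ∘ Φ_R`, `p^R = R² p ∘ Φ_R`, `Φ_R(s, y) = (t₀ + R² s, x₀ + R y)`, lies in the class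
`IsSuitableWeakSolutionInBall 1 0` of Albritton–Barker / Lin (restriction of the hypotheses to
`Q(z₀, R)`, rescaling, the proved `ess_suitable_of_L3infty'_holds`, and the proved bridge
`IsESSSuitablePairOn.isSuitableWeakSolutionInBall_unit`). [cite: EscauriazaSereginSverak2003, §3 (3.8)–(3.9)] -/
theorem zoom_isSuitableWeakSolutionInBall
    (h : IsL3inftyLocalPair 1 1 ((0 : ℝ), (0 : EuclideanSpace ℝ (Fin 3))) v p)
    {z₀ : ℝ × EuclideanSpace ℝ (Fin 3)}
    (hz₀ : z₀ ∈ closure (parabolicCylinder (1 / 2) ((0 : ℝ), (0 : EuclideanSpace ℝ (Fin 3)))))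
    {R : ℝ} (hR : R ∈ Ioc (0 : ℝ) (1 / 2)) :
    IsSuitableWeakSolutionInBall 1 0 (R • stPull (R ^ 2) R z₀.1 z₀.2 v)
      (R ^ 2 • stPull (R ^ 2) R z₀.1 z₀.2 p) := by
  obtain ⟨hI, hB⟩ := intervals_subset_of_mem_closure_half hz₀ hR.1.le hR.2
  have hres : IsL3inftyLocalPair 1 R (z₀.1, z₀.2) v p := h.restrict hI hB
  obtain ⟨h1, h2, h3, h4, h5⟩ := IsL3inftyLocalPair.unit_iff.1 (hres.stRescale one_pos hR.1)
  have hsuit := (ess_suitable_of_L3infty'_holds _ _ h1 h2 h3 h4 h5).isSuitableWeakSolutionInBall_unit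
  simpa only [div_one, one_pow] using hsuit

/-- `‖u^R‖³_{L³(Q(1))} = C(R; z₀) ≤ M` for the rescaled velocity (`lintegral_cube_zoom` and
`exists_cknC_le`). [cite: EscauriazaSereginSverak2003, §3 (3.10)] -/
theorem lintegral_cube_zoom_le {M : ℝ≥0}
    (hM : ∀ z₀ ∈ closure (parabolicCylinder (1 / 2) ((0 : ℝ), (0 : EuclideanSpace ℝ (Fin 3)))),
      ∀ r ∈ Ioc (0 : ℝ) (1 / 2), cknC r z₀ v ≤ M)
    {z₀ : ℝ × EuclideanSpace ℝ (Fin 3)}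
    (hz₀ : z₀ ∈ closure (parabolicCylinder (1 / 2) ((0 : ℝ), (0 : EuclideanSpace ℝ (Fin 3)))))
    {R : ℝ} (hR : R ∈ Ioc (0 : ℝ) (1 / 2)) :
    ∫⁻ w in parabolicCylinder 1 (0 : ℝ × EuclideanSpace ℝ (Fin 3)),
        ‖(R • stPull (R ^ 2) R z₀.1 z₀.2 v) w.1 w.2‖ₑ ^ 3 ≤ M := by
  rw [lintegral_cube_zoom hR.1 z₀ v]
  exact hM z₀ hz₀ R hR

/-- `‖p^R‖^{3/2}_{L^{3/2}(Q(1))} = D(R; z₀) ≤ D⋆` for the rescaled pressure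
(`lintegral_pressure_zoom` and `exists_cknD_le`). [cite: EscauriazaSereginSverak2003, §3 (3.11)] -/
theorem lintegral_pressure_zoom_le {D : ℝ≥0} {z₀ : ℝ × EuclideanSpace ℝ (Fin 3)}
    (hD : ∀ r ∈ Ioc (0 : ℝ) (1 / 2), cknD r z₀ p ≤ D) {R : ℝ} (hR : R ∈ Ioc (0 : ℝ) (1 / 2)) :
    ∫⁻ w in parabolicCylinder 1 (0 : ℝ × EuclideanSpace ℝ (Fin 3)),
        ‖(R ^ 2 • stPull (R ^ 2) R z₀.1 z₀.2 p) w.1 w.2‖ₑ ^ (3 / 2 : ℝ) ≤ D := by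
  rw [lintegral_pressure_zoom hR.1 z₀ p]
  exact hD R hR

/-- **Uniform `L³ × L^{3/2}` bound of the rescaled family on `Q(1)`** — the hypothesis of the
compactness theorem `SuitableCompactness` (Albritton–Barker 2019, Lemma 2.2) in its `eLpNorm`
form: `‖u^R‖_{L³(Q(1))} + ‖p^R‖_{L^{3/2}(Q(1))} ≤ M^{1/3} + D⋆^{2/3}` for all `0 < R ≤ 1/2`. [cite: AlbrittonBarker2019, Lemma 2.2] [cite: EscauriazaSereginSverak2003, §3 (3.10)–(3.11)] -/
theorem eLpNorm_zoom_add_le {M D : ℝ≥0}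
    (hM : ∀ z₀ ∈ closure (parabolicCylinder (1 / 2) ((0 : ℝ), (0 : EuclideanSpace ℝ (Fin 3)))),
      ∀ r ∈ Ioc (0 : ℝ) (1 / 2), cknC r z₀ v ≤ M)
    {z₀ : ℝ × EuclideanSpace ℝ (Fin 3)}
    (hz₀ : z₀ ∈ closure (parabolicCylinder (1 / 2) ((0 : ℝ), (0 : EuclideanSpace ℝ (Fin 3)))))
    (hD : ∀ r ∈ Ioc (0 : ℝ) (1 / 2), cknD r z₀ p ≤ D) {R : ℝ} (hR : R ∈ Ioc (0 : ℝ) (1 / 2)) :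
    eLpNorm (uncurry (R • stPull (R ^ 2) R z₀.1 z₀.2 v)) 3
        (volume.restrict (parabolicCylinder 1 (0 : ℝ × EuclideanSpace ℝ (Fin 3)))) +
      eLpNorm (uncurry (R ^ 2 • stPull (R ^ 2) R z₀.1 z₀.2 p)) (3 / 2)
        (volume.restrict (parabolicCylinder 1 (0 : ℝ × EuclideanSpace ℝ (Fin 3)))) ≤
      (M : ℝ≥0∞) ^ (1 / 3 : ℝ) + (D : ℝ≥0∞) ^ (2 / 3 : ℝ) := by
  refine add_le_add ?_ ?_
  · rw [eLpNorm_eq_lintegral_rpow_enorm_toReal (by norm_num) (by norm_num)]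
    have e : (3 : ℝ≥0∞).toReal = 3 := by norm_num
    rw [e, show (1 / 3 : ℝ) = 1 / 3 from rfl]
    refine ENNReal.rpow_le_rpow ?_ (by norm_num)
    have h1 := lintegral_cube_zoom_le hM hz₀ hR
    refine le_trans (le_of_eq ?_) h1
    refine lintegral_congr fun w => ?_
    rw [show (3 : ℝ) = ((3 : ℕ) : ℝ) by norm_num, ENNReal.rpow_natCast]
    rfl
  · rw [eLpNorm_eq_lintegral_rpow_enorm_toReal (by norm_num)
      (ENNReal.div_ne_top (by norm_num) (by norm_num))]
    have e : (3 / 2 : ℝ≥0∞).toReal = 3 / 2 := by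
      rw [ENNReal.toReal_div]; norm_num
    rw [e, show (1 / (3 / 2) : ℝ) = 2 / 3 by norm_num]
    refine ENNReal.rpow_le_rpow ?_ (by norm_num)
    exact lintegral_pressure_zoom_le hD hR

/-- **Scale covariance of the cubic functional**: for `0 < R`, `0 < a`,
`∫_{Q(a)} |u^R|³ = a² C(aR; z₀)` (change of variables along `Φ_R`, whose preimage of
`Q(z₀, aR)` is `Q(a)`; `dz = R⁵ dz'`). [cite: EscauriazaSereginSverak2003, §3 (3.10) (the scaling of C)] -/
theorem lintegral_cube_zoom_radius {R a : ℝ} (hR : 0 < R) (ha : 0 < a)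
    (z₀ : ℝ × EuclideanSpace ℝ (Fin 3))
    (v : ℝ → EuclideanSpace ℝ (Fin 3) → EuclideanSpace ℝ (Fin 3)) :
    ∫⁻ w in parabolicCylinder a ((0 : ℝ), (0 : EuclideanSpace ℝ (Fin 3))),
        ‖(R • stPull (R ^ 2) R z₀.1 z₀.2 v) w.1 w.2‖ₑ ^ (3 : ℕ) =
      ENNReal.ofReal a ^ 2 * cknC (a * R) z₀ v := by
  -- the preimage of `Q(z₀, aR)` under `Φ_R` is `Q(a)`
  have hpre : stAffine (R ^ 2) R z₀.1 z₀.2 ⁻¹' parabolicCylinder (a * R) z₀ =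
      parabolicCylinder a ((0 : ℝ), (0 : EuclideanSpace ℝ (Fin 3))) := by
    have h1 := stAffine_preimage_cylinder_eq_parabolicCylinder (ν := (1 : ℝ)) one_pos hR z₀.1 z₀.2
      (a * R)
    rw [div_one, div_one, mul_div_cancel_right₀ a hR.ne'] at h1
    rw [← h1, parabolicCylinder]
  set F : ℝ × EuclideanSpace ℝ (Fin 3) → ℝ≥0∞ := fun z => ‖v z.1 z.2‖ₑ ^ (3 : ℕ) with hF
  have key : ∀ w : ℝ × EuclideanSpace ℝ (Fin 3),
      ‖(R • stPull (R ^ 2) R z₀.1 z₀.2 v) w.1 w.2‖ₑ ^ (3 : ℕ) =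
        ENNReal.ofReal (R ^ 3) * F (stAffine (R ^ 2) R z₀.1 z₀.2 w) := by
    intro w
    have e1 : (R • stPull (R ^ 2) R z₀.1 z₀.2 v) w.1 w.2 =
        R • v (z₀.1 + R ^ 2 * w.1) (z₀.2 + R • w.2) := rfl
    rw [e1, enorm_smul, mul_pow, Real.enorm_eq_ofReal hR.le, ← ENNReal.ofReal_pow hR.le, hF]
    rfl
  simp_rw [key]
  rw [lintegral_const_mul' _ _ ENNReal.ofReal_ne_top, ← hpre,
    setLIntegral_preimage_comp_stAffine (pow_pos hR 2) hR z₀.1 z₀.2 F,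
    finrank_euclideanSpace_fin_three, cknC, ← mul_assoc, ← mul_assoc,
    ← ENNReal.ofReal_mul (by positivity), ← ENNReal.ofReal_pow ha.le,
    Lemma142.inv_ofReal_sq (by positivity), ← ENNReal.ofReal_mul (by positivity)]
  congr 1
  congr 1
  field_simp

/-- `C` is scale covariant: `C(a; 0)[u^R] = C(aR; z₀)[v]` (`0 < R`, `0 < a`). [cite: EscauriazaSereginSverak2003, §3 (3.10)] -/
theorem cknC_zoom {R a : ℝ} (hR : 0 < R) (ha : 0 < a) (z₀ : ℝ × EuclideanSpace ℝ (Fin 3))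
    (v : ℝ → EuclideanSpace ℝ (Fin 3) → EuclideanSpace ℝ (Fin 3)) :
    cknC a ((0 : ℝ), (0 : EuclideanSpace ℝ (Fin 3))) (R • stPull (R ^ 2) R z₀.1 z₀.2 v) =
      cknC (a * R) z₀ v := by
  rw [cknC, lintegral_cube_zoom_radius hR ha z₀ v, ← mul_assoc,
    ENNReal.inv_mul_cancel (pow_ne_zero 2 (ENNReal.ofReal_pos.2 ha).ne')
      (ENNReal.pow_ne_top ENNReal.ofReal_ne_top), one_mul]

/-- **Scale covariance of the pressure functional**: for `0 < R`, `0 < a`,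
`∫_{Q(a)} |p^R|^{3/2} = a² D(aR; z₀)` (`|R² p|^{3/2} = R³ |p|^{3/2}`, `dz = R⁵ dz'`). [cite: EscauriazaSereginSverak2003, §3 (3.11) (the scaling of D)] -/
theorem lintegral_pressure_zoom_radius {R a : ℝ} (hR : 0 < R) (ha : 0 < a)
    (z₀ : ℝ × EuclideanSpace ℝ (Fin 3)) (p : ℝ → EuclideanSpace ℝ (Fin 3) → ℝ) :
    ∫⁻ w in parabolicCylinder a ((0 : ℝ), (0 : EuclideanSpace ℝ (Fin 3))),
        ‖(R ^ 2 • stPull (R ^ 2) R z₀.1 z₀.2 p) w.1 w.2‖ₑ ^ (3 / 2 : ℝ) =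
      ENNReal.ofReal a ^ 2 * cknD (a * R) z₀ p := by
  have hpre : stAffine (R ^ 2) R z₀.1 z₀.2 ⁻¹' parabolicCylinder (a * R) z₀ =
      parabolicCylinder a ((0 : ℝ), (0 : EuclideanSpace ℝ (Fin 3))) := by
    have h1 := stAffine_preimage_cylinder_eq_parabolicCylinder (ν := (1 : ℝ)) one_pos hR z₀.1 z₀.2
      (a * R)
    rw [div_one, div_one, mul_div_cancel_right₀ a hR.ne'] at h1
    rw [← h1, parabolicCylinder]
  set F : ℝ × EuclideanSpace ℝ (Fin 3) → ℝ≥0∞ := fun z => ‖p z.1 z.2‖ₑ ^ (3 / 2 : ℝ) with hF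
  have key : ∀ w : ℝ × EuclideanSpace ℝ (Fin 3),
      ‖(R ^ 2 • stPull (R ^ 2) R z₀.1 z₀.2 p) w.1 w.2‖ₑ ^ (3 / 2 : ℝ) =
        ENNReal.ofReal (R ^ 3) * F (stAffine (R ^ 2) R z₀.1 z₀.2 w) := by
    intro w
    have e1 : (R ^ 2 • stPull (R ^ 2) R z₀.1 z₀.2 p) w.1 w.2 =
        R ^ 2 • p (z₀.1 + R ^ 2 * w.1) (z₀.2 + R • w.2) := rfl
    rw [e1, enorm_smul, ENNReal.mul_rpow_of_nonneg _ _ (by norm_num),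
      Real.enorm_eq_ofReal (sq_nonneg R), ENNReal.ofReal_rpow_of_nonneg (sq_nonneg R) (by norm_num),
      sq_rpow_three_halves hR.le, hF]
    rfl
  simp_rw [key]
  rw [lintegral_const_mul' _ _ ENNReal.ofReal_ne_top, ← hpre,
    setLIntegral_preimage_comp_stAffine (pow_pos hR 2) hR z₀.1 z₀.2 F,
    finrank_euclideanSpace_fin_three, cknD, ← mul_assoc, ← mul_assoc,
    ← ENNReal.ofReal_mul (by positivity), ← ENNReal.ofReal_pow ha.le,
    Lemma142.inv_ofReal_sq (by positivity), ← ENNReal.ofReal_mul (by positivity)]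
  congr 1
  congr 1
  field_simp

/-- `D` is scale covariant: `D(a; 0)[p^R] = D(aR; z₀)[p]` (`0 < R`, `0 < a`). [cite: EscauriazaSereginSverak2003, §3 (3.11)] -/
theorem cknD_zoom {R a : ℝ} (hR : 0 < R) (ha : 0 < a) (z₀ : ℝ × EuclideanSpace ℝ (Fin 3))
    (p : ℝ → EuclideanSpace ℝ (Fin 3) → ℝ) :
    cknD a ((0 : ℝ), (0 : EuclideanSpace ℝ (Fin 3))) (R ^ 2 • stPull (R ^ 2) R z₀.1 z₀.2 p) =
      cknD (a * R) z₀ p := by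
  rw [cknD, lintegral_pressure_zoom_radius hR ha z₀ p, ← mul_assoc,
    ENNReal.inv_mul_cancel (pow_ne_zero 2 (ENNReal.ofReal_pos.2 ha).ne')
      (ENNReal.pow_ne_top ENNReal.ofReal_ne_top), one_mul]

/-- **Non-triviality survives the rescaling** (Seregin 2014, (6.6.1); ESS 2003, §3 (3.12)): at a
point with `C(ρ; z₀) ≥ η` for all `0 < ρ ≤ 1/2`, the rescaled velocities satisfy
`∫_{Q(a)} |u^R|³ ≥ η a²` for every `0 < a` with `aR ≤ 1/2`. [cite: Seregin2014, §6.6 (6.6.1)] [cite: EscauriazaSereginSverak2003, §3 (3.12)] -/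
theorem ofReal_sq_mul_eta_le_lintegral_cube_zoom {z₀ : ℝ × EuclideanSpace ℝ (Fin 3)} {η : ℝ}
    (hη : ∀ ρ ∈ Ioc (0 : ℝ) (1 / 2), ENNReal.ofReal η ≤ cknC ρ z₀ v) {R a : ℝ} (hR : 0 < R)
    (ha : 0 < a) (haR : a * R ≤ 1 / 2) :
    ENNReal.ofReal (a ^ 2 * η) ≤
      ∫⁻ w in parabolicCylinder a ((0 : ℝ), (0 : EuclideanSpace ℝ (Fin 3))),
        ‖(R • stPull (R ^ 2) R z₀.1 z₀.2 v) w.1 w.2‖ₑ ^ (3 : ℕ) := by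
  rw [lintegral_cube_zoom_radius hR ha z₀ v]
  by_cases hη0 : 0 ≤ η
  · rw [ENNReal.ofReal_mul (sq_nonneg a), ENNReal.ofReal_pow ha.le]
    exact mul_le_mul' le_rfl (hη (a * R) ⟨by positivity, haR⟩)
  · rw [not_le] at hη0
    rw [ENNReal.ofReal_of_nonpos (by nlinarith [sq_nonneg a])]
    exact bot_le

/-- **The sliced `L³` bound is scale invariant** (Seregin 2014, p. 129: "by scale-invariance,
`‖u‖_{3,∞} < +∞`"): with `M` the sliced bound (1.16) of `v` on `Q(1)`, for `z₀ ∈ Q̄(1/2)` and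
`0 < R ≤ 1/2` the rescaled velocity satisfies `∫_{B(1/(2R))} |u^R(s)|³ ≤ M` for a.e.
`s ∈ ]-3/(4R²), 0[` (the times `t₀ + R² s ∈ ]t₀ - 3/4, t₀[ ⊆ ]-1, 0[`, the balls
`x₀ + R B(1/(2R)) = B(x₀, 1/2) ⊆ B(1)`). [cite: Seregin2014, §6.6 p. 129] [cite: EscauriazaSereginSverak2003, §3 (3.10)] -/
theorem exists_ae_lintegral_ball_cube_zoom_le
    (h : IsL3inftyLocalPair 1 1 ((0 : ℝ), (0 : EuclideanSpace ℝ (Fin 3))) v p) :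
    ∃ M : ℝ≥0, ∀ z₀ ∈ closure (parabolicCylinder (1 / 2) ((0 : ℝ), (0 : EuclideanSpace ℝ (Fin 3)))),
      ∀ R ∈ Ioc (0 : ℝ) (1 / 2),
        ∀ᵐ s ∂(volume.restrict (Ioo (-(3 / 4) / R ^ 2) 0)),
          ∫⁻ y in ball (0 : EuclideanSpace ℝ (Fin 3)) (1 / (2 * R)),
            ‖(R • stPull (R ^ 2) R z₀.1 z₀.2 v) s y‖ₑ ^ (3 : ℕ) ≤ M := by
  obtain ⟨-, -, -, -, ⟨C₃, h5⟩⟩ := IsL3inftyLocalPair.unit_iff.1 h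
  refine ⟨C₃, fun z₀ hz₀ R hR => ?_⟩
  obtain ⟨⟨ht, ht'⟩, hx⟩ := mem_closure_half_iff.1 hz₀
  have hR0 : 0 < R := hR.1
  have hβ : 0 < R ^ 2 := pow_pos hR0 2
  -- the sliced bound on the sub-cylinder `]t₀ - 3/4, t₀[ × B(x₀, 1/2)`
  have hI : Ioo (z₀.1 + R ^ 2 * (-(3 / 4) / R ^ 2)) (z₀.1 + R ^ 2 * 0) ⊆ Ioo (-1 : ℝ) 0 := by
    rw [mul_div_cancel₀ _ hβ.ne', mul_zero, add_zero]
    exact Ioo_subset_Ioo (by linarith) ht'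
  have hB : ball z₀.2 (1 / 2) ⊆ ball (0 : EuclideanSpace ℝ (Fin 3)) 1 :=
    ball_subset_unitBall_of_half hx le_rfl
  have h5' : ∀ᵐ t ∂(volume.restrict (Ioo (z₀.1 + R ^ 2 * (-(3 / 4) / R ^ 2)) (z₀.1 + R ^ 2 * 0))),
      ∫⁻ y in ball z₀.2 (1 / 2), (fun t x => ‖v t x‖ₑ ^ (3 : ℕ)) t y ≤ C₃ := by
    filter_upwards [ae_restrict_of_ae_restrict_of_subset hI h5] with t hts
    exact (lintegral_mono_set hB).trans hts
  have h6 := ae_sliced_setLIntegral_ball_stRescale hβ hR0 z₀.1 z₀.2 z₀.2 (1 / 2)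
    (-(3 / 4) / R ^ 2) 0 (fun t x => ‖v t x‖ₑ ^ (3 : ℕ)) h5'
  rw [sub_self, smul_zero, finrank_euclideanSpace_fin_three] at h6
  have hrad : (1 / 2 : ℝ) / R = 1 / (2 * R) := by rw [div_div]
  rw [hrad] at h6
  filter_upwards [h6] with s hs
  have key : ∀ y : EuclideanSpace ℝ (Fin 3),
      ‖(R • stPull (R ^ 2) R z₀.1 z₀.2 v) s y‖ₑ ^ (3 : ℕ) =
        ENNReal.ofReal (R ^ 3) * ‖v (z₀.1 + R ^ 2 * s) (z₀.2 + R • y)‖ₑ ^ (3 : ℕ) := by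
    intro y
    have e1 : (R • stPull (R ^ 2) R z₀.1 z₀.2 v) s y = R • v (z₀.1 + R ^ 2 * s) (z₀.2 + R • y) := rfl
    rw [e1, enorm_smul, mul_pow, Real.enorm_eq_ofReal hR0.le, ← ENNReal.ofReal_pow hR0.le]
  simp_rw [key]
  rw [lintegral_const_mul' _ _ ENNReal.ofReal_ne_top]
  calc ENNReal.ofReal (R ^ 3) * ∫⁻ y in ball (0 : EuclideanSpace ℝ (Fin 3)) (1 / (2 * R)),
        ‖v (z₀.1 + R ^ 2 * s) (z₀.2 + R • y)‖ₑ ^ (3 : ℕ)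
      ≤ ENNReal.ofReal (R ^ 3) * (ENNReal.ofReal (R ^ 3)⁻¹ * C₃) := mul_le_mul' le_rfl hs
    _ = C₃ := by
        rw [← mul_assoc, ENNReal.ofReal_inv_of_pos (pow_pos hR0 3),
          ENNReal.mul_inv_cancel (ENNReal.ofReal_pos.2 (pow_pos hR0 3)).ne' ENNReal.ofReal_ne_top,
          one_mul]

end Zoom

end Literature.Analysis.FluidPDE
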